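import Mathlib
import Summits.ValiantsHypothesis.ValiantsHypothesis.Theorems.BarrierLeverPartitionMinorsHitByVPHiddenStatesStarParamFamily

/-!
# Route BarrierLever — item `PartitionMinorsHitByVP` (stmt-ValiantsHypothesis-19717):
# the STAR OBSTRUCTION for EVERY `h ≥ 6`, part 2/2 — the hypothesis of the `K = h` door is unsatisfiable

Helper file (`--supports stmt-ValiantsHypothesis-19717`; cell valiant-natproofs, rung V4, 𝒟-side of door (c); prover seat
val-np-p3 gen 8). Closes NO item. Parametric version of `…HiddenStatesStar` (`not_ballGood_star6`, seat g7).

For every `n` put `h = K = n + 6` and `r = (n + 7) + 5`. The row family `pstarU n` = `∅`, the `h` singletons, the 5-star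
`{0,1},…,{0,5}`; the ball–colex hidden family of size `r` on `K = h` states is `pstarE n` = `∅`, the `K` singletons,
`{0,1},{0,2},{1,2},{0,3},{1,3}` (`pstarE_threshold`). For EVERY table the additive matrix is singular (`det_pM_eq_zero`):
the five star rows `ℓ_0 ℓ_{b}` combine (a nonzero `β` with `Σ_b β_b t_{q,b} = 0` for the four states `q ≤ 3` carrying the
hidden pairs — four equations, five unknowns) into a function that is AFFINE on the hidden family (`sum_star_rows`), and
together with the `h + 1` affine rows `∅, {a}` these are `h + 2` vectors from the `(h+1)`-dimensional space of affine
coefficient vectors — dependent (`exists_dependence`, a zero-row padding of the coefficient matrix). Hence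

* `not_ballGood_pstar : ∀ n, ¬ BallGood (n+6) (n+6) (n+7+5) (pstarU n)`;
* **`not_ballGood_hypothesis`**: `¬ ∃ h₁, ∀ h ≥ h₁, ∀ r u, Injective u → BallGood h h r u` — the hypothesis of the door
  `partitionMinorsHitByVP_of_ballGood` (Conjecture Q\* with exactly `K = h` hidden states) is unsatisfiable, for every `h₁`.

The variable-`K` doors (`_of_ballGood'`, `_of_ballGood_cube`) and the JOIN door (`…HiddenStatesJoin`) are unaffected.
WHAT THIS IS NOT: nothing on `K > h`, on CPM, crux 14610 or VP ≠ VNP.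
-/

set_option linter.dupNamespace false

namespace Summit.ValiantsHypothesis.ValiantsHypothesis.Theorems.BarrierLever.HiddenStates

open Finset Matrix

noncomputable section

namespace StarParam

variable (n : ℕ)

/-! ### The additive matrix is singular for every table -/

variable (tx : Option (Fin (n + 6)) → Fin (n + 6) → ℂ)

/-- Row `∅` of the additive matrix is constant `1`. -/
theorem pM_empty (k : Fin (n + 6 + 1 + 5)) :
    (∏ a ∈ pstarU n (Fin.castAdd 5 0), (tx none a + ∑ q ∈ pstarE n k, tx (some q) a)) = 1 := by
  simp

/-- Row `{a}` of the additive matrix is `L_a`. -/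
theorem pM_single (a : Fin (n + 6)) (k : Fin (n + 6 + 1 + 5)) :
    (∏ a' ∈ pstarU n (Fin.castAdd 5 a.succ), (tx none a' + ∑ q ∈ pstarE n k, tx (some q) a')) =
      tx none a + ∑ q ∈ pstarE n k, tx (some q) a := by
  simp

/-- Star row `{0, b+1}` of the additive matrix is `L_0 · L_{b+1}`. -/
theorem pM_star (b : Fin 5) (k : Fin (n + 6 + 1 + 5)) :
    (∏ a ∈ pstarU n (Fin.natAdd (n + 6 + 1) b), (tx none a + ∑ q ∈ pstarE n k, tx (some q) a)) =
      (tx none (el n 0) + ∑ q ∈ pstarE n k, tx (some q) (el n 0)) *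
        (tx none (el n (b + 1) (by omega)) + ∑ q ∈ pstarE n k, tx (some q) (el n (b + 1) (by omega))) := by
  have h0 : el n 0 ≠ el n (b + 1) (by omega) := by
    intro h; have := congrArg Fin.val h; simp at this
  rw [pstarU_right, Finset.prod_pair h0]

/-- **Step A.** A nonzero `β : Fin 5 → ℂ` with `Σ_b β_b · t_{q, b+1} = 0` for the four states `q ≤ 3`
(four linear equations in five unknowns: pad with a zero row and use `det = 0`). -/
theorem exists_beta : ∃ β : Fin 5 → ℂ, β ≠ 0 ∧
    ∀ q : Fin (n + 6), (q : ℕ) ≤ 3 → ∑ b : Fin 5, β b * tx (some q) (el n (b + 1) (by omega)) = 0 := by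
  classical
  set T : Matrix (Fin 5) (Fin 5) ℂ := Matrix.of fun q b =>
    if hq : (q : ℕ) ≤ 3 then tx (some (el n q (by omega))) (el n (b + 1) (by omega)) else 0 with hT
  have hdet : T.det = 0 := by
    refine Matrix.det_eq_zero_of_row_eq_zero (4 : Fin 5) fun b => ?_
    rw [hT, Matrix.of_apply, dif_neg]
    decide
  obtain ⟨β, hβ, hTβ⟩ := Matrix.exists_mulVec_eq_zero_iff.mpr hdet
  refine ⟨β, hβ, fun q hq => ?_⟩
  have hq' : (q : ℕ) < 5 := by omega
  have := congrFun hTβ ⟨q, hq'⟩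
  rw [Matrix.mulVec, dotProduct, Pi.zero_apply] at this
  rw [← this, hT]
  refine Finset.sum_congr rfl fun b _ => ?_
  rw [Matrix.of_apply, dif_pos (show ((⟨(q : ℕ), hq'⟩ : Fin 5) : ℕ) ≤ 3 from hq), mul_comm]
  congr 2

/-- **Step B.** With such a `β`, the combination `Σ_b β_b ℓ_0 ℓ_{b+1}` of the five star rows is AFFINE on the hidden family:
at hidden point `k` it equals `c₀ G + Σ_{q ∈ E_k} φ_q`. -/
theorem sum_star_rows (β : Fin 5 → ℂ)
    (hβ : ∀ q : Fin (n + 6), (q : ℕ) ≤ 3 → ∑ b : Fin 5, β b * tx (some q) (el n (b + 1) (by omega)) = 0)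
    (k : Fin (n + 6 + 1 + 5)) :
    ∑ b : Fin 5, β b * ((tx none (el n 0) + ∑ q ∈ pstarE n k, tx (some q) (el n 0)) *
        (tx none (el n (b + 1) (by omega)) + ∑ q ∈ pstarE n k, tx (some q) (el n (b + 1) (by omega)))) =
      tx none (el n 0) * (∑ b : Fin 5, β b * tx none (el n (b + 1) (by omega))) +
        ∑ q ∈ pstarE n k, ((tx none (el n 0) + tx (some q) (el n 0)) *
          ((∑ b : Fin 5, β b * tx none (el n (b + 1) (by omega))) +
            ∑ b : Fin 5, β b * tx (some q) (el n (b + 1) (by omega))) -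
          tx none (el n 0) * ∑ b : Fin 5, β b * tx none (el n (b + 1) (by omega))) := by
  -- abbreviations (local, no definitions)
  set c0 : ℂ := tx none (el n 0) with hc0
  set G : ℂ := ∑ b : Fin 5, β b * tx none (el n (b + 1) (by omega)) with hG
  set γ : Fin (n + 6) → ℂ := fun q => ∑ b : Fin 5, β b * tx (some q) (el n (b + 1) (by omega)) with hγ
  set L0 : Fin (n + 6 + 1 + 5) → ℂ := fun k => c0 + ∑ q ∈ pstarE n k, tx (some q) (el n 0) with hL0
  set Lb : Fin 5 → Fin (n + 6 + 1 + 5) → ℂ := fun b k =>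
    tx none (el n (b + 1) (by omega)) + ∑ q ∈ pstarE n k, tx (some q) (el n (b + 1) (by omega)) with hLb
  change ∑ b : Fin 5, β b * (L0 k * Lb b k) = c0 * G + ∑ q ∈ pstarE n k, ((c0 + tx (some q) (el n 0)) * (G + γ q) - c0 * G)
  -- the β-combination of the `L_{b+1}` is `G + Σ_{q ∈ E k} γ q`
  have hcomb : ∑ b : Fin 5, β b * Lb b k = G + ∑ q ∈ pstarE n k, γ q := by
    simp only [hLb, hG, hγ, mul_add, Finset.sum_add_distrib, Finset.mul_sum]
    rw [Finset.sum_comm]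
  have hlhs : ∑ b : Fin 5, β b * (L0 k * Lb b k) = L0 k * (G + ∑ q ∈ pstarE n k, γ q) := by
    rw [← hcomb, Finset.mul_sum]
    exact Finset.sum_congr rfl fun b _ => by ring
  rw [hlhs]
  induction k using Fin.addCases with
  | left j =>
    induction j using Fin.cases with
    | zero =>
      have hE : pstarE n (Fin.castAdd 5 (0 : Fin (n + 6 + 1))) = ∅ := by simp
      simp only [hE, Finset.sum_empty, add_zero, hL0]
    | succ a =>
      have hE : pstarE n (Fin.castAdd 5 a.succ) = {a} := by simp
      simp only [hE, Finset.sum_singleton, hL0]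
      ring
  | right b =>
    have h12 := el_p1_ne_el_p2 n b
    have hγ1 : γ (el n (p1 b) (by have := p1_lt b; omega)) = 0 := hβ _ (by have := p1_lt b; simp; omega)
    have hγ2 : γ (el n (p2 b) (by have := p2_lt b; omega)) = 0 := hβ _ (by have := p2_lt b; simp; omega)
    have hE : pstarE n (Fin.natAdd (n + 6 + 1) b) = hpair n b := by simp
    simp only [hE, hpair, hL0, Finset.sum_pair h12]
    rw [hγ1, hγ2]
    ring

/-- **Step C.** `h + 2` vectors in the `(h+1)`-dimensional space of affine coefficient vectors are dependent: there are
`d : Option (Option (Fin (n+6))) → ℂ`, not all zero, with `Σ_ι d_ι w_ι = 0` for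
`w_(some none) = (1; 0)`, `w_(some (some a)) = (c_a; t_{·,a})`, `w_none = (G₀; φ)`. -/
theorem exists_dependence (G0 : ℂ) (φ : Fin (n + 6) → ℂ) :
    ∃ d : Option (Option (Fin (n + 6))) → ℂ, d ≠ 0 ∧
      (d (some none) + ∑ a : Fin (n + 6), d (some (some a)) * tx none a + d none * G0 = 0) ∧
      ∀ q : Fin (n + 6), ∑ a : Fin (n + 6), d (some (some a)) * tx (some q) a + d none * φ q = 0 := by
  classical
  -- coefficient vectors, coordinates indexed by `Option (Fin (n+6))` (constant term, then the states)
  let w : Option (Option (Fin (n + 6))) → Option (Fin (n + 6)) → ℂ := fun ι p =>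
    Option.elim ι (Option.elim p G0 φ)
      (fun ι' => Option.elim ι' (Option.elim p 1 fun _ => 0) fun a => Option.elim p (tx none a) fun q => tx (some q) a)
  -- square matrix with a zero row
  let Wm : Matrix (Option (Option (Fin (n + 6)))) (Option (Option (Fin (n + 6)))) ℂ :=
    Matrix.of fun ρ ι => Option.elim ρ 0 fun p => w ι p
  have hdet : Wm.det = 0 := Matrix.det_eq_zero_of_row_eq_zero none fun ι => by simp [Wm]
  obtain ⟨d, hd, hWd⟩ := Matrix.exists_mulVec_eq_zero_iff.mpr hdet
  refine ⟨d, hd, ?_, fun q => ?_⟩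
  · have h1 := congrFun hWd (some none)
    simp only [Wm, w, Matrix.mulVec, dotProduct, Matrix.of_apply, Pi.zero_apply, Fintype.sum_option,
      Option.elim_none, Option.elim_some] at h1
    have h2 : ∑ a : Fin (n + 6), d (some (some a)) * tx none a = ∑ a : Fin (n + 6), tx none a * d (some (some a)) :=
      Finset.sum_congr rfl fun a _ => mul_comm _ _
    rw [h2]
    linear_combination h1
  · have h1 := congrFun hWd (some (some q))
    simp only [Wm, w, Matrix.mulVec, dotProduct, Matrix.of_apply, Pi.zero_apply, Fintype.sum_option,
      Option.elim_none, Option.elim_some] at h1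
    have h2 : ∑ a : Fin (n + 6), d (some (some a)) * tx (some q) a =
        ∑ a : Fin (n + 6), tx (some q) a * d (some (some a)) := Finset.sum_congr rfl fun a _ => mul_comm _ _
    rw [h2]
    linear_combination h1

/-- **The additive matrix of the star family is singular for every table** (`h = K = n + 6`, `r = n + 12`):
the matrix of `BallGood` for `pstarU` against `pstarE` has determinant `0`. -/
theorem det_pM_eq_zero :
    (Matrix.of fun i k : Fin (n + 6 + 1 + 5) =>
      ∏ a ∈ pstarU n i, (tx none a + ∑ q ∈ pstarE n k, tx (some q) a)).det = 0 := by
  classical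
  obtain ⟨β, hβ0, hβ⟩ := exists_beta n tx
  obtain ⟨d, hd0, hdc, hdq⟩ := exists_dependence n tx
    (tx none (el n 0) * ∑ b : Fin 5, β b * tx none (el n (b + 1) (by omega)))
    (fun q => (tx none (el n 0) + tx (some q) (el n 0)) *
          ((∑ b : Fin 5, β b * tx none (el n (b + 1) (by omega))) +
            ∑ b : Fin 5, β b * tx (some q) (el n (b + 1) (by omega))) -
          tx none (el n 0) * ∑ b : Fin 5, β b * tx none (el n (b + 1) (by omega)))
  beta_reduce at hdq
  -- the row combination
  let c : Fin (n + 6 + 1 + 5) → ℂ :=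
    Fin.addCases (Fin.cases (d (some none)) fun a => d (some (some a))) fun b => d none * β b
  have hcz : c (Fin.castAdd 5 0) = d (some none) := by simp [c]
  have hcs : ∀ a : Fin (n + 6), c (Fin.castAdd 5 a.succ) = d (some (some a)) := fun a => by simp [c]
  have hcb : ∀ b : Fin 5, c (Fin.natAdd (n + 6 + 1) b) = d none * β b := fun b => by simp [c]
  have hc_ne : c ≠ 0 := by
    intro hc0'
    apply hd0
    by_cases hdn : d none = 0
    · funext ι
      rcases ι with _ | ⟨_ | a⟩
      · exact hdn
      · rw [← hcz, hc0']; rfl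
      · rw [← hcs a, hc0']; rfl
    · exfalso
      apply hβ0
      funext b
      have := hcb b
      rw [hc0'] at this
      exact ((mul_eq_zero.mp this.symm).resolve_left hdn)
  refine Matrix.exists_vecMul_eq_zero_iff.mp ⟨c, hc_ne, ?_⟩
  funext k
  rw [Matrix.vecMul, dotProduct, Pi.zero_apply, Fin.sum_univ_add, Fin.sum_univ_succ]
  simp only [Matrix.of_apply, hcz, hcs, hcb, pM_empty, pM_single, pM_star]
  have hstar : ∑ b : Fin 5, d none * β b *
      ((tx none (el n 0) + ∑ q ∈ pstarE n k, tx (some q) (el n 0)) *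
        (tx none (el n (b + 1) (by omega)) + ∑ q ∈ pstarE n k, tx (some q) (el n (b + 1) (by omega)))) =
      d none * (tx none (el n 0) * (∑ b : Fin 5, β b * tx none (el n (b + 1) (by omega))) +
        ∑ q ∈ pstarE n k, ((tx none (el n 0) + tx (some q) (el n 0)) *
          ((∑ b : Fin 5, β b * tx none (el n (b + 1) (by omega))) +
            ∑ b : Fin 5, β b * tx (some q) (el n (b + 1) (by omega))) -
          tx none (el n 0) * ∑ b : Fin 5, β b * tx none (el n (b + 1) (by omega)))) := by
    rw [← sum_star_rows n tx β hβ k, Finset.mul_sum]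
    exact Finset.sum_congr rfl fun b _ => by ring
  rw [hstar, mul_one]
  -- regroup: (constant part) + Σ_{q ∈ E k} (q-part), both vanish by the dependence
  have hsplit : ∑ a : Fin (n + 6), d (some (some a)) * (tx none a + ∑ q ∈ pstarE n k, tx (some q) a) =
      ∑ a : Fin (n + 6), d (some (some a)) * tx none a +
        ∑ q ∈ pstarE n k, ∑ a : Fin (n + 6), d (some (some a)) * tx (some q) a := by
    simp only [mul_add, Finset.mul_sum, Finset.sum_add_distrib]
    rw [Finset.sum_comm]
  rw [hsplit]
  have hq0 : ∑ q ∈ pstarE n k, (∑ a : Fin (n + 6), d (some (some a)) * tx (some q) a +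
      d none * ((tx none (el n 0) + tx (some q) (el n 0)) *
          ((∑ b : Fin 5, β b * tx none (el n (b + 1) (by omega))) +
            ∑ b : Fin 5, β b * tx (some q) (el n (b + 1) (by omega))) -
          tx none (el n 0) * ∑ b : Fin 5, β b * tx none (el n (b + 1) (by omega)))) = 0 :=
    Finset.sum_eq_zero fun q _ => hdq q
  rw [Finset.sum_add_distrib, ← Finset.mul_sum] at hq0
  linear_combination hdc + hq0

end StarParam

open StarParam

/-- **The star family is not `BallGood (n+6) (n+6) (n+12)` for ANY `n`.** -/
theorem not_ballGood_pstar (n : ℕ) : ¬ BallGood (n + 6) (n + 6) (n + 6 + 1 + 5) (pstarU n) := by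
  intro hgood
  obtain ⟨tx, htx⟩ := hgood (pstarE n) (pstarE_injective n) (pstarE_threshold n)
  exact htx (det_pM_eq_zero n tx)

/-- **The hypothesis of the `K = h` door is unsatisfiable.** For NO `h₁` is every injective family of subsets of `Fin h`
ball-good with exactly `K = h` hidden states for all `h ≥ h₁` (the star family at `h = max h₁ 6` fails). Hence
`partitionMinorsHitByVP_of_ballGood` can never be applied; the variable-`K` and join doors are unaffected. -/
theorem not_ballGood_hypothesis :
    ¬ ∃ h₁ : ℕ, ∀ h : ℕ, h₁ ≤ h → ∀ (r : ℕ) (u : Fin r → Finset (Fin h)), Function.Injective u →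
      BallGood h h r u := by
  rintro ⟨h₁, H⟩
  have hle : h₁ ≤ (max h₁ 6 - 6) + 6 := by omega
  exact not_ballGood_pstar (max h₁ 6 - 6) (H _ hle _ (pstarU _) (pstarU_injective _))

end

end Summit.ValiantsHypothesis.ValiantsHypothesis.Theorems.BarrierLever.HiddenStates
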